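import Summits.CriticalPhenomena.SAWScalingLimit.Theses.SAWTrackTransport
import Summits.CriticalPhenomena.SAWScalingLimit.Theses.SAWCompassLattice
import Summits.CriticalPhenomena.SAWScalingLimit.Theorems.SAWCompassLatticeSurfaceUniversalityTollReduction

/-!
# `YBtoUniform` (stmt-CriticalPhenomena-16966) is, inside its own route, the summit conjunct

Crux-strategist census fact for the crux `Summit.CriticalPhenomena.SAWScalingLimit.Theses.SAWTrackTransport.YBtoUniform`
(route `SAWTrackTransport`, rank 6; "YB → uniform `ℤ²` toll": GM's critical square-tiling
Yang–Baxter law `ybLaw (π/2)` and the critical `δℤ²` law `SAW.law` merge on bounded continuous test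
functions of `CurveClass ℂ`). Three kernel-checked statements, all `sorry`-free:

* `ybSquareSLE_of_trackTransport` — **the route minus its toll supplies `YBSquareSLE`**: the five
  other cruxes of `SAWTrackTransport` (`AngleUniversality`, `YBLimitExists`, `AxiomsOfLimit`,
  `RStarRot`, `MirrorRotation`) prove chordal SLE(8/3) convergence of the critical square-tiling
  Yang–Baxter walk for EVERY port endpoint approximation — verbatim the item
  `SAWCompassLattice.YBSquareSLE` (stmt-CriticalPhenomena-6967) of the sibling route. (The proof is
  the deciding theorem `SAWTrackTransport.closes` stopped one step short: reflection trick ⇒ rotation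
  covariance ⇒ similarity covariance ⇒ `RStarRot` ⇒ conformal covariance ⇒ Lawler–Schramm–Werner
  2003 (`LawlerSchrammWerner2003_holds`, PROVED Literature theorem) ⇒ `P D` is the SLE(8/3) law; the
  robust limit at `u ≡ 0` gives the convergence.)
* `ybToUniform_of_sawScalingLimit` — **the summit pays the toll**: `YBSquareSLE → SAWScalingLimit →
  YBtoUniform` (two families converging to chordal SLE(8/3) curves of one Dobrushin domain merge:
  `Toll.tendsto_sub_of_sle`, SLE(8/3) in `D` being ONE law).
* `ybToUniform_iff_sawScalingLimit` — with the landed `Toll.sawScalingLimit_of_toll`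
  (`YBSquareSLE → YBtoUniform → SAWScalingLimit`): **given `YBSquareSLE`, the toll `YBtoUniform` is
  EQUIVALENT to the sub-problem statement `SAWScalingLimit`**; and its in-route form
  `ybToUniform_iff_sawScalingLimit_of_trackTransport`: given the five other cruxes of the route, the
  sixth is literally the summit conjunct.

Reading (census, `Cruxes/YBtoUniform/STRATEGY-CENSUS.md`): any line for this crux that uses the
route's own context (the Yang–Baxter side converges) is a proof of `SAWScalingLimit`; any line that
does not is finite-mesh universality between two critical face-weight points of the square lattice
(the registered line `Lines/birth.lean`: tightness 1881 + Lipschitz legs), for which no mechanism is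
in print. Nothing here is specific to SLE beyond uniqueness in law; no new hypothesis is introduced.
-/

noncomputable section

namespace Summit.CriticalPhenomena.SAWScalingLimit.Theorems.YBtoUniform.SummitEquivalent

open MeasureTheory Filter Topology Set
open scoped NNReal ENNReal
open Literature.Probability.RandomPlanarGeometry
open Literature.Probability.RandomPlanarGeometry.SAW
open Literature.Probability.RandomPlanarGeometry.SAW.YangBaxter
open Literature.Probability.LatticeModels (Site)
open Summit.CriticalPhenomena.SAWScalingLimit.Theses
open Summit.CriticalPhenomena.SAWScalingLimit.Theses.SAWTrackTransport

/-- **Route `SAWTrackTransport` minus its toll proves `YBSquareSLE` (stmt-6967).** The five cruxes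
`AngleUniversality`, `YBLimitExists`, `AxiomsOfLimit`, `RStarRot`, `MirrorRotation` give chordal
SLE(8/3) convergence of GM's critical square-tiling Yang–Baxter walk (`ybLaw (π/2)`, `x = 1`, curve
`YBWalk.curve`) in every Dobrushin domain, for every port endpoint approximation.
[cite: DKKMO2020Rotational, §7] [cite: LawlerSchrammWerner2003Restriction, p. 5 result 2] -/
theorem ybSquareSLE_of_trackTransport (h₂ : AngleUniversality) (h₃ : YBLimitExists)
    (h₄ : AxiomsOfLimit) (h₅ : RStarRot) (h₇ : MirrorRotation) :
    SAWCompassLattice.YBSquareSLE := by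
  intro D a' b' happ
  -- `π/2` lies in Glazman–Manolescu's range `[π/3, 2π/3]`
  have hpi : Real.pi / 2 ∈ Set.Icc (Real.pi / 3) (2 * Real.pi / 3) := by
    constructor <;> nlinarith [Real.pi_pos]
  -- endpoint approximations at every angle, and the robust full limit `P` of the square-tiling walk
  obtain ⟨happAll, P, hPch, hconv⟩ := h₃
  have h₉' : ∀ D : DobrushinDomain, ∃ a b : ℝ → MidEdge,
      IsYBEndpointApprox (fun (_ : ℤ) => Real.pi / 2) D a b :=
    fun D => happAll (Real.pi / 2) hpi D
  -- the axioms of the limit that need no rotation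
  obtain ⟨-, hSimOfRot, hRM, hRev, hConj, hSimple⟩ := h₄ P hPch h₉' hconv
  -- rotation covariance from angle universality (track transport) by the reflection trick
  have hrot := h₇ h₂ happAll P hPch hconv
  have hSim : P.IsSimilarityCovariant := hSimOfRot hrot
  -- rotation-invariant restriction–Markov rigidity: conformal covariance
  have hCC : P.IsConformallyCovariant := h₅ P hPch hRM hRev hSim hConj hSimple
  -- Lawler–Schramm–Werner 2003 (PROVED Literature theorem): `P D` is the chordal SLE_{8/3} law
  obtain ⟨Γ, hΓ, hlaw⟩ := LawlerSchrammWerner2003_holds P hPch hCC hRM.isRestriction hSimple D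
  -- the robust limit specialised to the unshifted domain (`u ≡ 0`) and to the GIVEN endpoints
  have hD : (D.map (similarity 1 one_ne_zero 0)).carrier = D.carrier := by
    ext z; simp [MarkedDomain.carrier_map]
  have hu : ∀ᶠ δ in 𝓝[>] (0 : ℝ), ‖(fun _ : ℝ => (0 : ℂ)) δ‖ ≤ δ := by
    filter_upwards [self_mem_nhdsWithin] with δ hδ
    simpa using le_of_lt hδ
  have hconv0 := hconv D (fun _ : ℝ => (0 : ℂ)) a' b' hu
  have key : ∀ T : Set ℂ, T = D.carrier →
      ((∀ᶠ δ in 𝓝[>] (0 : ℝ), Nonempty (YangBaxterSAW (fun (_ : ℤ) => Real.pi / 2) T δ (a' δ) (b' δ))) →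
        Tendsto (fun δ : ℝ => (δ : ℂ) * planeMidpoint (fun (_ : ℤ) => Real.pi / 2) (a' δ))
          (𝓝[>] (0 : ℝ)) (𝓝 (D.pt 0)) →
        Tendsto (fun δ : ℝ => (δ : ℂ) * planeMidpoint (fun (_ : ℤ) => Real.pi / 2) (b' δ))
          (𝓝[>] (0 : ℝ)) (𝓝 (D.pt 1)) →
        TendstoLaw (fun δ (γ : YangBaxterSAW (fun (_ : ℤ) => Real.pi / 2) T δ (a' δ) (b' δ)) =>
            γ.curve (fun (_ : ℤ) => Real.pi / 2) δ)
          (fun δ => ybLaw (fun (_ : ℤ) => Real.pi / 2) T δ 1 (a' δ) (b' δ)) id (P D)) →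
      TendstoLaw (fun δ (γ : YangBaxterSAW (fun (_ : ℤ) => Real.pi / 2) D.carrier δ (a' δ) (b' δ)) =>
          γ.curve (fun (_ : ℤ) => Real.pi / 2) δ)
        (fun δ => ybLaw (fun (_ : ℤ) => Real.pi / 2) D.carrier δ 1 (a' δ) (b' δ)) id (P D) := by
    intro T hT h
    subst hT
    exact h happ.nonempty happ.tendsto_fst happ.tendsto_snd
  have hfix := key _ hD hconv0
  refine ⟨Γ, hΓ, Filter.Eventually.of_forall fun δ => YBWalk.aemeasurable_curve _ _ _ _ _ _,
    fun f => ?_⟩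
  have hlim : ∫ ω, f (Γ ω) ∂Literature.Probability.Process.preWienerMeasure = ∫ x, f x ∂(P D) := by
    rw [hlaw, MeasureTheory.integral_map hΓ.aemeasurable f.continuous.aestronglyMeasurable]
  rw [hlim]
  exact hfix f

/-- **The summit pays the toll.** If GM's critical square-tiling Yang–Baxter walk converges to chordal
SLE(8/3) (`YBSquareSLE`, stmt-6967) and the critical `δℤ²` SAW does too (`SAWScalingLimit`, the
sub-problem statement), then the two finite-mesh laws merge on every bounded continuous test
function: both converge to SLE(8/3) curves of `D`, and SLE(8/3) in `D` is one law
(`Toll.tendsto_sub_of_sle`). [folklore] -/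
theorem ybToUniform_of_sawScalingLimit (hY : SAWCompassLattice.YBSquareSLE)
    (hS : _root_.SAWScalingLimit) : YBtoUniform := by
  intro D a b a' b' hab happ f
  obtain ⟨Γ₁, hΓ₁, -, hT₁⟩ := hS D a b hab
  obtain ⟨Γ₂, hΓ₂, -, hT₂⟩ := hY D a' b' happ
  exact SurfaceUniversality.Toll.tendsto_sub_of_sle hΓ₁ hΓ₂ hT₁ hT₂ f

/-- **Given `YBSquareSLE`, the toll is the summit**: `YBtoUniform ↔ SAWScalingLimit`
(`→`: the landed toll reduction `Toll.sawScalingLimit_of_toll`; `←`: `ybToUniform_of_sawScalingLimit`).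
[folklore] -/
theorem ybToUniform_iff_sawScalingLimit (hY : SAWCompassLattice.YBSquareSLE) :
    YBtoUniform ↔ _root_.SAWScalingLimit :=
  ⟨SurfaceUniversality.Toll.sawScalingLimit_of_toll hY, ybToUniform_of_sawScalingLimit hY⟩

/-- **In-route form**: given the five other cruxes of route `SAWTrackTransport`, its sixth crux
`YBtoUniform` is EQUIVALENT to the sub-problem statement `SAWScalingLimit`. [folklore] -/
theorem ybToUniform_iff_sawScalingLimit_of_trackTransport (h₂ : AngleUniversality)
    (h₃ : YBLimitExists) (h₄ : AxiomsOfLimit) (h₅ : RStarRot) (h₇ : MirrorRotation) :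
    YBtoUniform ↔ _root_.SAWScalingLimit :=
  ybToUniform_iff_sawScalingLimit (ybSquareSLE_of_trackTransport h₂ h₃ h₄ h₅ h₇)

/-- The deciding theorem recovered (sanity check that nothing was lost): the six cruxes give the
summit conjunct, now factored through `YBSquareSLE`. [folklore] -/
theorem sawScalingLimit_of_cruxes (h₂ : AngleUniversality) (h₃ : YBLimitExists)
    (h₄ : AxiomsOfLimit) (h₅ : RStarRot) (h₆ : YBtoUniform) (h₇ : MirrorRotation) :
    _root_.SAWScalingLimit :=
  (ybToUniform_iff_sawScalingLimit_of_trackTransport h₂ h₃ h₄ h₅ h₇).1 h₆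

/-! ### Registered stubs of stmt-CriticalPhenomena-16966 (one-line signatures, proved verbatim) -/

/-- Registered stub `stub_ybSquareSLEOfTrackTransport`: the route minus its toll gives stmt-6967.
[folklore] -/
theorem stub_ybSquareSLEOfTrackTransport : SAWTrackTransport.AngleUniversality → SAWTrackTransport.YBLimitExists → SAWTrackTransport.AxiomsOfLimit → SAWTrackTransport.RStarRot → SAWTrackTransport.MirrorRotation → SAWCompassLattice.YBSquareSLE :=
  ybSquareSLE_of_trackTransport

/-- Registered stub `stub_summitPaysToll`: `YBSquareSLE → SAWScalingLimit → YBtoUniform`.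
[folklore] -/
theorem stub_summitPaysToll : SAWCompassLattice.YBSquareSLE → _root_.SAWScalingLimit → SAWTrackTransport.YBtoUniform :=
  ybToUniform_of_sawScalingLimit

/-- Registered stub `stub_tollIffSummit`: given `YBSquareSLE`, the toll is the summit conjunct.
[folklore] -/
theorem stub_tollIffSummit : SAWCompassLattice.YBSquareSLE → (SAWTrackTransport.YBtoUniform ↔ _root_.SAWScalingLimit) :=
  ybToUniform_iff_sawScalingLimit

/-- Registered stub `stub_tollIffSummitInRoute`: given the five other cruxes of `SAWTrackTransport`,
the toll is the summit conjunct. [folklore] -/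
theorem stub_tollIffSummitInRoute : SAWTrackTransport.AngleUniversality → SAWTrackTransport.YBLimitExists → SAWTrackTransport.AxiomsOfLimit → SAWTrackTransport.RStarRot → SAWTrackTransport.MirrorRotation → (SAWTrackTransport.YBtoUniform ↔ _root_.SAWScalingLimit) :=
  ybToUniform_iff_sawScalingLimit_of_trackTransport

end Summit.CriticalPhenomena.SAWScalingLimit.Theorems.YBtoUniform.SummitEquivalent

end
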